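import Summits.Ventures.PercRepro.ProfilePointedCircuitClassesStarNineSerB

/-!
# PercRepro — THE SERIES-PAIR REGIME OF `StarNine` COMPLETED, PART C: THE SERIES-TRIPLE THEOREM
(p5, gen 57; `proofs/P5-GM1.md` §85)

With the structure of a series triple `{b, b′, c}` (part B) — every bi-independent `4`-set contains exactly one
of the three points, the `b`-cells are the counts of the minor `N ／ b ∖ b′`, where `c` is a coloop and the
complementation `Y ↦ (E − Y) − c` exchanges «through `p`» with «avoiding `p`» — the counts of `N` are
`in_4(e) = 3 · in_3(e)`, `thru_4({e, f}) = 3 · thru_3({e, f})` for `e, f` outside the triple, `in_4(b) = P_3 = 2 · in_3(p)`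
and `thru_4({b, f}) = in_3(f)`, and (★)₉ follows at every position of `{e, f}` relative to the triple:
`starNine_of_seriesTriple`.
-/

open scoped Matroid

namespace PercRepro.Cogirth

open Finset ThmH Skew Shadow Profile

open Classical

variable {α : Type} [DecidableEq α] {N : Matroid α} [N.Finite]

section StarNineSerC

/-- `e ∈ insert x (W.erase y) ↔ e ∈ W` for `e ∉ {x, y}`. -/
theorem mem_insert_erase_iff_of_ne {e x y : α} (hex : e ≠ x) (hey : e ≠ y) (W : Finset α) :
    e ∈ insert x (W.erase y) ↔ e ∈ W := by
  rw [mem_insert, mem_erase]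
  exact ⟨fun h => h.elim (fun h' => absurd h' hex) (fun h' => h'.2), fun h => Or.inr ⟨hey, h⟩⟩

/-- `{e, f} ⊆ insert x (W.erase y) ↔ {e, f} ⊆ W` for `e, f ∉ {x, y}`. -/
theorem pair_subset_insert_erase_iff_of_ne {e f x y : α} (hex : e ≠ x) (hey : e ≠ y) (hfx : f ≠ x) (hfy : f ≠ y)
    (W : Finset α) : ({e, f} : Finset α) ⊆ insert x (W.erase y) ↔ ({e, f} : Finset α) ⊆ W := by
  rw [insert_subset_iff, singleton_subset_iff, insert_subset_iff, singleton_subset_iff,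
    mem_insert_erase_iff_of_ne hex hey, mem_insert_erase_iff_of_ne hfx hfy]

/-- **THE MINOR OF A SERIES TRIPLE**: `N ／ b ∖ b′` has seven points, rank `4`, and `c` is a coloop of it; `e ∈ E`
outside the triple lies in it. -/
theorem minor_hyps_of_seriesTriple (hn : (gr N).card = 9) (hR : rk N (gr N) = 5) {b b' c : α}
    (h : SeriesPair N b b') (h' : SeriesPair N b' c) (hbc : b ≠ c) :
    (gr ((N ／ ({b} : Set α)) ＼ ({b'} : Set α))).card = 7 ∧
    rk ((N ／ ({b} : Set α)) ＼ ({b'} : Set α)) (gr ((N ／ ({b} : Set α)) ＼ ({b'} : Set α))) = 4 ∧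
    c ∈ gr ((N ／ ({b} : Set α)) ＼ ({b'} : Set α)) ∧
    rk ((N ／ ({b} : Set α)) ＼ ({b'} : Set α)) ((gr ((N ／ ({b} : Set α)) ＼ ({b'} : Set α))).erase c) = 3 := by
  refine ⟨?_, ?_, ?_, rk_erase_minor_of_seriesTriple hR h h' hbc⟩
  · have := card_gr_minor_add_two_of_seriesPair (N := N) h
    rw [hn] at this; omega
  · have := rk_gr_minor_add_one_of_seriesPair (N := N) h
    rw [hR] at this; omega
  · rw [gr_minor_of_seriesPair]
    exact mem_erase.2 ⟨h'.2.2.1.symm, mem_erase.2 ⟨hbc.symm, h'.2.1⟩⟩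

/-- **THE COUNTS OF A POINT OUTSIDE A SERIES TRIPLE**: `in_4(e) = 3 · in_3(e)` of the minor `N ／ b ∖ b′`. -/
theorem inCount_eq_three_mul_of_seriesTriple (hn : (gr N).card = 9) (hR : rk N (gr N) = 5) {b b' c e : α}
    (h : SeriesPair N b b') (h' : SeriesPair N b' c) (hbc : b ≠ c) (heb : e ≠ b) (heb' : e ≠ b') (hec : e ≠ c) :
    inCount N 4 e = 3 * inCount ((N ／ ({b} : Set α)) ＼ ({b'} : Set α)) 3 e := by
  unfold inCount
  rw [card_filter_eq_three_mul_of_seriesTriple hn hR h h' hbc (fun W => e ∈ W)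
    (mem_insert_erase_iff_of_ne heb' heb) (mem_insert_erase_iff_of_ne heb heb')
    (mem_insert_erase_iff_of_ne hec heb) (mem_insert_erase_iff_of_ne heb hec),
    card_filter_minor_insert_left_eq_of_seriesPair h 3 (fun Y => e ∈ Y) (fun Y => by
      rw [mem_insert]; exact ⟨fun h'' => h''.resolve_left heb, fun h'' => Or.inr h''⟩)]

/-- **THE `thru` COUNT OF TWO POINTS OUTSIDE A SERIES TRIPLE**: `thru_4({e, f}) = 3 · thru_3({e, f})` of the minor. -/
theorem thruCount_pair_eq_three_mul_of_seriesTriple (hn : (gr N).card = 9) (hR : rk N (gr N) = 5)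
    {b b' c e f : α} (h : SeriesPair N b b') (h' : SeriesPair N b' c) (hbc : b ≠ c) (heb : e ≠ b) (heb' : e ≠ b')
    (hec : e ≠ c) (hfb : f ≠ b) (hfb' : f ≠ b') (hfc : f ≠ c) :
    thruCount N 4 {e, f} = 3 * thruCount ((N ／ ({b} : Set α)) ＼ ({b'} : Set α)) 3 {e, f} := by
  unfold thruCount
  rw [card_filter_eq_three_mul_of_seriesTriple hn hR h h' hbc (fun W => ({e, f} : Finset α) ⊆ W)
    (pair_subset_insert_erase_iff_of_ne heb' heb hfb' hfb) (pair_subset_insert_erase_iff_of_ne heb heb' hfb hfb')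
    (pair_subset_insert_erase_iff_of_ne hec heb hfc hfb) (pair_subset_insert_erase_iff_of_ne heb hec hfb hfc),
    card_filter_minor_insert_left_eq_of_seriesPair h 3 (fun Y => ({e, f} : Finset α) ⊆ Y) (fun Y => by
      rw [insert_subset_iff, singleton_subset_iff, insert_subset_iff, singleton_subset_iff, mem_insert,
        mem_insert]
      constructor
      · rintro ⟨h1, h2⟩
        exact ⟨h1.resolve_left heb, h2.resolve_left hfb⟩
      · rintro ⟨h1, h2⟩
        exact ⟨Or.inr h1, Or.inr h2⟩)]

/-- **THE COUNT OF A POINT OF THE TRIPLE**: `in_4(b) = P_3` of the minor `N ／ b ∖ b′`. -/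
theorem inCount_mem_eq_of_seriesTriple (hn : (gr N).card = 9) (hR : rk N (gr N) = 5) {b b' : α}
    (h : SeriesPair N b b') :
    inCount N 4 b = (biIndepSets ((N ／ ({b} : Set α)) ＼ ({b'} : Set α)) 3).card := by
  have hn4 : (gr N).card = rk N (gr N) + 4 := by omega
  have h1 := card_filter_minor_insert_left_eq_of_seriesPair h 3 (fun _ => True) (fun _ => Iff.rfl)
  rw [filter_true_of_mem (fun _ _ => trivial)] at h1
  rw [h1]
  unfold inCount
  apply congrArg Finset.card
  apply filter_congr
  intro W hW
  exact ⟨fun hbW => ⟨⟨trivial, hbW⟩, not_mem_of_mem_biIndepSets_of_seriesPair h hn4 hW hbW⟩,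
    fun h' => h'.1.2⟩

/-- **THE `thru` COUNT OF A POINT OF THE TRIPLE WITH AN OUTSIDE POINT**: `thru_4({b, f}) = in_3(f)` of the minor. -/
theorem thruCount_mem_pair_eq_of_seriesTriple (hn : (gr N).card = 9) (hR : rk N (gr N) = 5) {b b' f : α}
    (h : SeriesPair N b b') (hfb : f ≠ b) :
    thruCount N 4 {b, f} = inCount ((N ／ ({b} : Set α)) ＼ ({b'} : Set α)) 3 f := by
  have hn4 : (gr N).card = rk N (gr N) + 4 := by omega
  have h1 := card_filter_minor_insert_left_eq_of_seriesPair h 3 (fun Y => f ∈ Y) (fun Y => by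
    rw [mem_insert]; exact ⟨fun h'' => h''.resolve_left hfb, fun h'' => Or.inr h''⟩)
  unfold inCount thruCount
  rw [h1]
  apply congrArg Finset.card
  apply filter_congr
  intro W hW
  rw [insert_subset_iff, singleton_subset_iff]
  exact ⟨fun h' => ⟨⟨h'.2, h'.1⟩, not_mem_of_mem_biIndepSets_of_seriesPair h hn4 hW h'.1⟩,
    fun h' => ⟨h'.1.2, h'.1.1⟩⟩

/-- **(★)₉ WITH A SERIES TRIPLE, BOTH POINTS OUTSIDE**: on a coloop-free `N` with `#E = 9`, `ρ(E) = 5` and series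
pairs `{b, b′}`, `{b′, c}` (`b ≠ c`), `in_4(e) ≤ in_4(f) + thru_4({e, f})` for `e ≠ f` outside `{b, b′, c}` — three
times (★)₇ on the minor `N ／ b ∖ b′`, where `c` is a coloop. -/
theorem starNine_of_seriesTriple_outside (hn : (gr N).card = 9) (hR : rk N (gr N) = 5) {b b' c e f : α}
    (h : SeriesPair N b b') (h' : SeriesPair N b' c) (hbc : b ≠ c) (he : e ∈ gr N) (hf : f ∈ gr N)
    (heb : e ≠ b) (heb' : e ≠ b') (hec : e ≠ c) (hfb : f ≠ b) (hfb' : f ≠ b') (hfc : f ≠ c) :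
    inCount N 4 e ≤ inCount N 4 f + thruCount N 4 {e, f} := by
  obtain ⟨hn7, hR4, hcM, hco⟩ := minor_hyps_of_seriesTriple hn hR h h' hbc
  have heM : e ∈ gr ((N ／ ({b} : Set α)) ＼ ({b'} : Set α)) := by
    rw [gr_minor_of_seriesPair]; exact mem_erase.2 ⟨heb', mem_erase.2 ⟨heb, he⟩⟩
  have hfM : f ∈ gr ((N ／ ({b} : Set α)) ＼ ({b'} : Set α)) := by
    rw [gr_minor_of_seriesPair]; exact mem_erase.2 ⟨hfb', mem_erase.2 ⟨hfb, hf⟩⟩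
  have hstar := starSeven_of_coloop hn7 hR4 hcM hco heM hfM hec hfc
  rw [inCount_eq_three_mul_of_seriesTriple hn hR h h' hbc heb heb' hec,
    inCount_eq_three_mul_of_seriesTriple hn hR h h' hbc hfb hfb' hfc,
    thruCount_pair_eq_three_mul_of_seriesTriple hn hR h h' hbc heb heb' hec hfb hfb' hfc]
  omega

/-- **(★)₉ WITH A SERIES TRIPLE, `e` IN THE TRIPLE**: `in_4(b) ≤ in_4(f) + thru_4({b, f})` for `f` outside
`{b, b′, c}` — `in_4(b) = P_3 = 2 · in_3(f)` on the minor (the coloop involution), `in_4(f) = 3 · in_3(f)`. -/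
theorem starNine_of_seriesTriple_left (hn : (gr N).card = 9) (hR : rk N (gr N) = 5) {b b' c f : α}
    (h : SeriesPair N b b') (h' : SeriesPair N b' c) (hbc : b ≠ c) (hf : f ∈ gr N) (hfb : f ≠ b) (hfb' : f ≠ b')
    (hfc : f ≠ c) : inCount N 4 b ≤ inCount N 4 f + thruCount N 4 {b, f} := by
  obtain ⟨hn7, hR4, hcM, hco⟩ := minor_hyps_of_seriesTriple hn hR h h' hbc
  have hfM : f ∈ gr ((N ／ ({b} : Set α)) ＼ ({b'} : Set α)) := by
    rw [gr_minor_of_seriesPair]; exact mem_erase.2 ⟨hfb', mem_erase.2 ⟨hfb, hf⟩⟩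
  have hout := outCount_three_eq_inCount_three_of_coloop_seven hn7 hR4 hcM hco hfM hfc
  have hP := inCount_add_outCount ((N ／ ({b} : Set α)) ＼ ({b'} : Set α)) 3 f
  rw [inCount_mem_eq_of_seriesTriple hn hR h, inCount_eq_three_mul_of_seriesTriple hn hR h h' hbc hfb hfb' hfc,
    thruCount_mem_pair_eq_of_seriesTriple hn hR h hfb]
  omega

/-- **(★)₉ WITH A SERIES TRIPLE, `f` IN THE TRIPLE**: `in_4(e) ≤ in_4(b) + thru_4({e, b})` for `e` outside
`{b, b′, c}` — `in_4(e) = 3 · in_3(e)`, `in_4(b) = 2 · in_3(e)`, `thru_4({e, b}) = in_3(e)` on the minor. -/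
theorem starNine_of_seriesTriple_right (hn : (gr N).card = 9) (hR : rk N (gr N) = 5) {b b' c e : α}
    (h : SeriesPair N b b') (h' : SeriesPair N b' c) (hbc : b ≠ c) (he : e ∈ gr N) (heb : e ≠ b) (heb' : e ≠ b')
    (hec : e ≠ c) : inCount N 4 e ≤ inCount N 4 b + thruCount N 4 {e, b} := by
  obtain ⟨hn7, hR4, hcM, hco⟩ := minor_hyps_of_seriesTriple hn hR h h' hbc
  have heM : e ∈ gr ((N ／ ({b} : Set α)) ＼ ({b'} : Set α)) := by
    rw [gr_minor_of_seriesPair]; exact mem_erase.2 ⟨heb', mem_erase.2 ⟨heb, he⟩⟩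
  have hout := outCount_three_eq_inCount_three_of_coloop_seven hn7 hR4 hcM hco heM hec
  have hP := inCount_add_outCount ((N ／ ({b} : Set α)) ＼ ({b'} : Set α)) 3 e
  have hcomm : ({e, b} : Finset α) = {b, e} := pair_comm e b
  rw [hcomm, inCount_mem_eq_of_seriesTriple hn hR h, inCount_eq_three_mul_of_seriesTriple hn hR h h' hbc heb heb' hec,
    thruCount_mem_pair_eq_of_seriesTriple hn hR h heb]
  omega

/-- **THE SERIES-TRIPLE REGIME OF `StarNine`**: on every matroid with `#E = 9`, `ρ(E) = 5` and series pairs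
`{b, b′}`, `{b′, c}` with `b ≠ c`, `in_4(e) ≤ in_4(f) + thru_4({e, f})` for all `e ≠ f` in `E`. -/
theorem starNine_of_seriesTriple (hn : (gr N).card = 9) (hR : rk N (gr N) = 5) {b b' c : α}
    (h : SeriesPair N b b') (h' : SeriesPair N b' c) (hbc : b ≠ c) {e f : α} (he : e ∈ gr N) (hf : f ∈ gr N)
    (hef : e ≠ f) : inCount N 4 e ≤ inCount N 4 f + thruCount N 4 {e, f} := by
  have hn4 : (gr N).card = rk N (gr N) + 4 := by omega
  have hbc' : SeriesPair N b c := h.trans h' hbc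
  have hbb' : b ≠ b' := h.2.2.1
  have hb'c : b' ≠ c := h'.2.2.1
  -- the two marked points inside the class: a series pair
  have hself : ∀ p q : α, (p = b ∨ p = b' ∨ p = c) → (q = b ∨ q = b' ∨ q = c) → p ≠ q →
      inCount N 4 p ≤ inCount N 4 q + thruCount N 4 {p, q} := by
    intro p q hp hq hpq
    apply starNine_of_seriesPair_self hn4
    rcases hp with rfl | rfl | rfl <;> rcases hq with rfl | rfl | rfl
    · exact absurd rfl hpq
    · exact h
    · exact hbc'
    · exact h.symm
    · exact absurd rfl hpq
    · exact h'
    · exact hbc'.symm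
    · exact h'.symm
    · exact absurd rfl hpq
  by_cases hein : e = b ∨ e = b' ∨ e = c
  · by_cases hfin : f = b ∨ f = b' ∨ f = c
    · exact hself e f hein hfin hef
    · rw [not_or, not_or] at hfin
      obtain ⟨hfb, hfb', hfc⟩ := hfin
      rcases hein with rfl | rfl | rfl
      · exact starNine_of_seriesTriple_left hn hR h h' hbc hf hfb hfb' hfc
      · exact starNine_of_seriesTriple_left hn hR h.symm hbc' hb'c hf hfb' hfb hfc
      · exact starNine_of_seriesTriple_left hn hR h'.symm h.symm hbc.symm hf hfc hfb' hfb
  · rw [not_or, not_or] at hein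
    obtain ⟨heb, heb', hec⟩ := hein
    by_cases hfin : f = b ∨ f = b' ∨ f = c
    · rcases hfin with rfl | rfl | rfl
      · exact starNine_of_seriesTriple_right hn hR h h' hbc he heb heb' hec
      · exact starNine_of_seriesTriple_right hn hR h.symm hbc' hb'c he heb' heb hec
      · exact starNine_of_seriesTriple_right hn hR h'.symm h.symm hbc.symm he hec heb' heb
    · rw [not_or, not_or] at hfin
      obtain ⟨hfb, hfb', hfc⟩ := hfin
      exact starNine_of_seriesTriple_outside hn hR h h' hbc he hf heb heb' hec hfb hfb' hfc

end StarNineSerC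

end PercRepro.Cogirth
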